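import Summits.MatrixMultiplication.OmegaCensus.DominoZ19Z19Cover4A
import HarnessLib

/-!
# Kernel covers on `ZMod 19 × ZMod 19`: part `4` (B: chunks 2–4, axis normal forms) (scaling-canonical table)

ω-census `pub-omega`, family (b3), seat pub-omega-group gen 21 (kit and generators of gen 20).  Framing: lottery ticket; floor =
certified bounds/negative ranges.  VALUE: the finite kernel computation behind the `ℤ_19 × ℤ_19` domino cell theorem with a
part `4` (`DominoZ19Z19Cells.lean`); NOT progress on ω.  Instances of the generic margin-pruned enumeration
`DominoZpZpEnum.lean` with the SCALED table soundness of `DominoZpZpScaled.lean` (table tree `BTree.build`, membership ⇒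
insertion).  Normal form (i): 13 547 leaves / 101 549 nodes in 5 chunks (key `polyBE 3 R % 5`, ≤ 23 227 nodes each);
files A (chunks 0–1, trees), B (chunks 2–4, axis normal forms); S (table soundness by prefix classes, imports A, `DominoZpZpSlices` and the part-3 cover file for `prime19`); B… import A only;
the assembly `exists_table_entry_19_4` lives in `DominoZ19Z19Cells.lean`.  Exact Python twin:
`pub-omega-group-g20/code/emulate2.py 19 4 m K`.
-/

namespace Summit.MatrixMultiplication.OmegaCensus

namespace ZpZpDomino

set_option maxHeartbeats 4000000 in
/-- Kernel cover computation, `p = 19`, `d = 4`, normal form (i), chunk `2` of `5` (key `polyBE 3 R % 5`). [folklore] -/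
theorem cover_19_4_nf1_2 : coverNF1 19 4 passTreeZ19d4 3 5 2 = true := by decide +kernel

set_option maxHeartbeats 4000000 in
/-- Kernel cover computation, `p = 19`, `d = 4`, normal form (i), chunk `3` of `5` (key `polyBE 3 R % 5`). [folklore] -/
theorem cover_19_4_nf1_3 : coverNF1 19 4 passTreeZ19d4 3 5 3 = true := by decide +kernel

set_option maxHeartbeats 4000000 in
/-- Kernel cover computation, `p = 19`, `d = 4`, normal form (i), chunk `4` of `5` (key `polyBE 3 R % 5`). [folklore] -/
theorem cover_19_4_nf1_4 : coverNF1 19 4 passTreeZ19d4 3 5 4 = true := by decide +kernel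

set_option maxHeartbeats 4000000 in
/-- Kernel cover computation, `p = 19`, `d = 4`, normal form (ii). [folklore] -/
theorem cover_19_4_nf2 : coverNF2 19 4 passTreeZ19d4 = true := by decide +kernel

/-- Kernel cover computation, `p = 19`, `d = 4`, normal form (iii). [folklore] -/
theorem cover_19_4_nf3 : coverNF3 19 4 passTreeZ19d4 = true := by decide +kernel

end ZpZpDomino

end Summit.MatrixMultiplication.OmegaCensus
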